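import Literature.Analysis.FluidPDE.DeRosaPerturbation
import Literature.Analysis.FluidPDE.FracNSEnergy
import Literature.Analysis.FluidPDE.OnsagerBDSVParameters
import Literature.Analysis.FluidPDE.OnsagerBDSVStressParams
import Literature.Analysis.FunctionSpaces.TorusHolderSobolevEmbedding
import Mathlib.Analysis.MeanInequalitiesPow
import HarnessLib

/-!
# De Rosa's perturbation stage: the energy balance of the glued NSR triple (Lemma 5.9) — part 0

L. De Rosa, *Infinitely many Leray–Hopf solutions for the fractional Navier–Stokes equations*,
Comm. PDE 44 (2019) 335–365 = arXiv:1801.10235, §5.3, proof of Lemma 5.9 (p. 15 of the arXiv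
text): "To prove [the bounds on `∂ₜρ_q`, `∂ₜρ_{q,i}`] we first note that
`|d/dt ∫|v̄_q(x,t)|² dx| ≤ 2|∫∇v̄_q·R̊̄_q dx| + 2ν∫|(-Δ)^{γ/2}v̄_q|² dx ≲ δ_{q+1}δ_q^{1/2}λ_qℓ^α`", the
dissipative integral being bounded, as in the proof of (5.18), through a spatial Hölder bound of
the velocity at an exponent above `γ` and **Cor. 7.2**: "`∫_{𝕋³}|(-Δ)^{γ/2}f|² ≤ C(ε)[f]²_{γ+ε}`
for all `f ∈ C^{γ+ε}(𝕋³)`".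

This file PROVES part 0 of `DeRosa.perturbationStage_of_parts` (`DeRosaPerturbation.lean`): the
NSR standing hypotheses `DeRosa.NSRHypotheses` imply the core hypotheses `DeRosa.CoreHypotheses`
(with the input constant `C_in` replaced by `DeRosa.coreConst C_in = 2(|C_in| + 1)`) once `α` is
small and `a` is large — the only field to prove being the energy-rate bound
`|d/dt∫|v̄_q|²| ≤ 6(C_in'δ_{q+1}ℓ^α)(C_in'δ_q^{1/2}λ_q)`:

* `Torus.integral_inner_fracLaplacian_self_le_of_holder` — **Cor. 7.2 in the form used**: for a
  smooth `v : T^d → ℝ^d` with `‖v‖ ≤ M` and `‖v(x) - v(y)‖ ≤ L dist(x,y)^r`, and `0 ≤ γ ≤ 1`,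
  `γ < r`: `0 ≤ ∫⟪(-Δ)^γ v, v⟫ ≤ (4π²)^γ (M² + K_{d,γ,r} L²)`, by the pairing in Fourier variables
  `∫⟪(-Δ)^γv, v⟫ = ∑ₖ (4π²|k|²)^γ ‖v̂(k)‖²` (`Torus.integral_inner_fracLaplacian_eq_tsum`) and
  Bernstein's embedding `C^{0,r} ⊂ H^γ` (`Torus.eSobolevNorm_sq_le_of_holder`);
* `BDSV.energyScaleX_inv_eq` — the scale `X = δ_{q+1} ℓ^α δ_q^{1/2} λ_q` as a monomial in
  `λ_q, λ_{q+1}`, and `DeRosa.exists_threshold_energyScaleX` — `X ≥ K` for `a` large when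
  `α < α₀(β, b)` (footnote 5 of the source: `δ_{q+1}δ_q^{1/2}λ_q ≥ a^{b^q(1-β-2βb)} ≥ 1`, with the
  harmless extra factor `ℓ^α`), via the master parameter lemma `BDSV.exists_freq_triple_le`;
* `DeRosa.core_part` — part 0: the energy balance of (NSR)
  (`Torus.IsFracNSReynoldsOn.hasDerivWithinAt_energy`), `|2∫∇v̄_q:R̊̄_q| ≤ 6(C_inδ_{q+1}ℓ^α)(C_inδ_q^{1/2}λ_q)`
  (`Torus.abs_energyRate_le`), `2ν∫⟪(-Δ)^γv̄_q, v̄_q⟫ ≤ 2K(C₀² + C_H²)` (`ν < 1`), absorbed by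
  the doubled constant since `X → ∞`.

## References

* L. De Rosa, Comm. PDE 44 (2019) 335–365 = arXiv:1801.10235, §5.3 Lemma 5.9 and its proof
  (p. 15, with footnote 5), §7 Cor. 7.2. [`Derosa2018`]
* T. Buckmaster, C. De Lellis, L. Székelyhidi Jr., V. Vicol, CPAM 72 (2019) = arXiv:1701.08678,
  Lemma 5.4 (5.18). [`BuckmasterEtAl2018`]
-/

open MeasureTheory Set Filter UnitAddTorus
open scoped NNReal ENNReal ContDiff InnerProductSpace

noncomputable section

namespace Literature.Analysis.FluidPDE

/-! ## Cor. 7.2: the dissipation of a Hölder field -/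

namespace Torus

open FunctionSpaces FunctionSpaces.Torus

variable {d : Type*} [Fintype d] [DecidableEq d]

/-- The pairing `∫⟪(-Δ)^γ v, v⟫` in Fourier variables: `∑ₖ (4π²|k|²)^γ ‖v̂(k)‖²` (real form of
`Torus.integral_inner_fracLaplacian_eq_tsum`). [folklore] -/
theorem integral_inner_fracLaplacian_self_eq_tsum {γ : ℝ} (hγ : 0 ≤ γ)
    {v : UnitAddTorus d → EuclideanSpace ℝ d} (hv : IsSmooth v) :
    ∫ x, ⟪fracLaplacian γ v x, v x⟫_ℝ =
      ∑' k : d → ℤ, fracSymbol γ k * ‖mFourierCoeff (EuclideanSpace.complexify ∘ v) k‖ ^ 2 := by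
  have h := integral_inner_fracLaplacian_eq_tsum hγ hv hv.continuous
  have hcomm : (fun x => ⟪fracLaplacian γ v x, v x⟫_ℝ) = fun x => ⟪v x, fracLaplacian γ v x⟫_ℝ :=
    funext fun x => real_inner_comm _ _
  rw [hcomm, h]
  refine tsum_congr fun k => ?_
  congr 1
  have h2 := inner_self_eq_norm_sq (𝕜 := ℂ) (mFourierCoeff (EuclideanSpace.complexify ∘ v) k)
  rwa [RCLike.re_to_complex] at h2

omit [DecidableEq d] in
/-- `(1 + |k|²)^γ ≤ 1 + (4π²|k|²)^γ` for `0 ≤ γ ≤ 1` (subadditivity of `t ↦ t^γ` and `4π² ≥ 1`).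
[folklore] -/
theorem sobolevWeight_sq_le_one_add_fracSymbol {γ : ℝ} (hγ : 0 ≤ γ) (hγ1 : γ ≤ 1) (k : d → ℤ) :
    sobolevWeight γ k ^ 2 ≤ 1 + fracSymbol γ k := by
  have hk := freqNormSq_nonneg k
  have hw : sobolevWeight γ k ^ 2 = (1 + freqNormSq k) ^ γ := by
    rw [sobolevWeight, ← Real.rpow_natCast, ← Real.rpow_mul (by linarith)]
    norm_num
  rw [hw]
  have h1 : (1 + freqNormSq k) ^ γ ≤ (1 : ℝ) ^ γ + freqNormSq k ^ γ :=
    Real.rpow_add_le_add_rpow zero_le_one hk hγ hγ1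
  rw [Real.one_rpow] at h1
  refine h1.trans (add_le_add le_rfl ?_)
  have h4 : (1 : ℝ) ≤ (4 * Real.pi ^ 2) ^ γ := Real.one_le_rpow (by nlinarith [Real.pi_gt_three]) hγ
  calc freqNormSq k ^ γ = 1 * freqNormSq k ^ γ := (one_mul _).symm
    _ ≤ (4 * Real.pi ^ 2) ^ γ * freqNormSq k ^ γ :=
        mul_le_mul_of_nonneg_right h4 (Real.rpow_nonneg hk γ)
    _ = fracSymbol γ k := by rw [fracSymbol, Real.mul_rpow (by positivity) hk]

omit [DecidableEq d] in
/-- `(4π²|k|²)^γ ≤ (4π²)^γ (1 + |k|²)^γ` for `γ ≥ 0`. [folklore] -/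
theorem fracSymbol_le_mul_sobolevWeight_sq {γ : ℝ} (hγ : 0 ≤ γ) (k : d → ℤ) :
    fracSymbol γ k ≤ (4 * Real.pi ^ 2) ^ γ * sobolevWeight γ k ^ 2 := by
  have hk := freqNormSq_nonneg k
  have hw : sobolevWeight γ k ^ 2 = (1 + freqNormSq k) ^ γ := by
    rw [sobolevWeight, ← Real.rpow_natCast, ← Real.rpow_mul (by linarith)]
    norm_num
  rw [hw, fracSymbol, Real.mul_rpow (by positivity) hk]
  exact mul_le_mul_of_nonneg_left (Real.rpow_le_rpow hk (by linarith) hγ) (Real.rpow_nonneg (by positivity) γ)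

/-- **Cor. 7.2 of De Rosa, in the form used by the scheme** ("`∫|(-Δ)^{γ/2}f|² ≤ C(ε)[f]²_{γ+ε}`"):
for a smooth field `v : T^d → ℝ^d` with `‖v‖ ≤ M` and `‖v(x) - v(y)‖ ≤ L dist(x,y)^r`, `0 ≤ γ ≤ 1`
and `γ < r`,
`∫⟪(-Δ)^γ v, v⟫ ≤ (4π²)^γ (M² + d(1+4d)^γ 4^{-2r}(2(1-4^{γ-r}))⁻¹ L²)` — the pairing is
`∑ₖ(4π²|k|²)^γ‖v̂(k)‖² ≤ (4π²)^γ ‖v‖²_{H^γ}` and `‖v‖²_{H^γ} ≤ M² + K L²` is Bernstein's embedding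
`C^{0,r} ⊂ H^γ` (`Torus.eSobolevNorm_sq_le_of_holder`). [cite: Derosa2018, §7 Cor. 7.2] -/
theorem integral_inner_fracLaplacian_self_le_of_holder {γ r : ℝ} (hγ : 0 ≤ γ) (hγ1 : γ ≤ 1)
    (hγr : γ < r) {v : UnitAddTorus d → EuclideanSpace ℝ d} (hv : IsSmooth v) {M L : ℝ}
    (hL : 0 ≤ L) (hM : ∀ x, ‖v x‖ ≤ M) (hH : ∀ x y, ‖v x - v y‖ ≤ L * dist x y ^ r) :
    ∫ x, ⟪fracLaplacian γ v x, v x⟫_ℝ ≤ (4 * Real.pi ^ 2) ^ γ * (M ^ 2 +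
      Fintype.card d * (1 + 4 * Fintype.card d) ^ γ * (4 : ℝ) ^ (-(2 * r)) *
        (2 * (1 - (4 : ℝ) ^ (γ - r)))⁻¹ * L ^ 2) := by
  classical
  set V : UnitAddTorus d → EuclideanSpace ℂ d := EuclideanSpace.complexify ∘ v with hV
  set K : ℝ := Fintype.card d * (1 + 4 * Fintype.card d) ^ γ * (4 : ℝ) ^ (-(2 * r)) *
    (2 * (1 - (4 : ℝ) ^ (γ - r)))⁻¹ with hK
  -- the complexified field has the same bounds
  have hVc : Continuous V := EuclideanSpace.continuous_complexify.comp hv.continuous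
  have hVM : ∀ x, ‖V x‖ ≤ M := fun x => by
    rw [hV, Function.comp_apply, EuclideanSpace.norm_complexify]; exact hM x
  have hVL : ∀ x y, ‖V x - V y‖ ≤ L * dist x y ^ r := fun x y => by
    rw [hV, Function.comp_apply, Function.comp_apply, ← map_sub, EuclideanSpace.norm_complexify]
    exact hH x y
  have hM0 : 0 ≤ M := (norm_nonneg _).trans (hM 0)
  -- the Bernstein bound, squared, in `ℝ≥0∞`
  have hB := eSobolevNorm_sq_le_of_holder hγ hγr hVc hL hVM hVL
  have hsq : eSobolevNorm γ V ^ 2 =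
      ∑' k : d → ℤ, ENNReal.ofReal (sobolevWeight γ k ^ 2) * ‖mFourierCoeff V k‖ₑ ^ 2 := by
    rw [eSobolevNorm, ← ENNReal.rpow_natCast, ← ENNReal.rpow_mul]
    norm_num
  -- the real sequences
  set g : (d → ℤ) → ℝ := fun k => sobolevWeight γ k ^ 2 * ‖mFourierCoeff V k‖ ^ 2 with hg
  set f : (d → ℤ) → ℝ := fun k => fracSymbol γ k * ‖mFourierCoeff V k‖ ^ 2 with hf
  have hg0 : ∀ k, 0 ≤ g k := fun k => mul_nonneg (sq_nonneg _) (sq_nonneg _)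
  have hf0 : ∀ k, 0 ≤ f k := fun k => mul_nonneg (fracSymbol_nonneg γ k) (sq_nonneg _)
  -- summability: `‖v̂(k)‖ ≤ M` and `∑ (1 + σ_k) ‖v̂(k)‖ < ∞` for smooth `v`
  have hcoef : ∀ k, ‖mFourierCoeff V k‖ ≤ M := fun k => norm_mFourierCoeff_le_of_forall_norm_le hVM k
  have hs0 : Summable fun k : d → ℤ => ‖mFourierCoeff V k‖ := by
    have h := summable_fracSymbol_mul_norm (θ := 0) le_rfl hv
    simp only [fracSymbol, Real.rpow_zero, one_mul] at h
    exact h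
  have hsγ : Summable fun k : d → ℤ => fracSymbol γ k * ‖mFourierCoeff V k‖ :=
    summable_fracSymbol_mul_norm hγ hv
  have hgs : Summable g := by
    refine Summable.of_nonneg_of_le hg0 (fun k => ?_) ((hs0.add hsγ).mul_left M)
    have hn := norm_nonneg (mFourierCoeff V k)
    calc g k ≤ (1 + fracSymbol γ k) * ‖mFourierCoeff V k‖ ^ 2 :=
          mul_le_mul_of_nonneg_right (sobolevWeight_sq_le_one_add_fracSymbol hγ hγ1 k) (sq_nonneg _)
      _ = (‖mFourierCoeff V k‖ + fracSymbol γ k * ‖mFourierCoeff V k‖) * ‖mFourierCoeff V k‖ := by ring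
      _ ≤ (‖mFourierCoeff V k‖ + fracSymbol γ k * ‖mFourierCoeff V k‖) * M :=
          mul_le_mul_of_nonneg_left (hcoef k) (add_nonneg hn (mul_nonneg (fracSymbol_nonneg γ k) hn))
      _ = M * (‖mFourierCoeff V k‖ + fracSymbol γ k * ‖mFourierCoeff V k‖) := mul_comm _ _
  have hfs : Summable f := by
    refine Summable.of_nonneg_of_le hf0 (fun k => ?_) (hgs.mul_left ((4 * Real.pi ^ 2) ^ γ))
    calc f k ≤ (4 * Real.pi ^ 2) ^ γ * sobolevWeight γ k ^ 2 * ‖mFourierCoeff V k‖ ^ 2 :=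
          mul_le_mul_of_nonneg_right (fracSymbol_le_mul_sobolevWeight_sq hγ k) (sq_nonneg _)
      _ = (4 * Real.pi ^ 2) ^ γ * g k := by rw [hg]; ring
  -- `∑ g ≤ M² + K L²` from the `ℝ≥0∞` bound
  have hKL : 0 ≤ M ^ 2 + K * L ^ 2 := by
    have hρ : (4 : ℝ) ^ (γ - r) < 1 := Real.rpow_lt_one_of_one_lt_of_neg (by norm_num) (by linarith)
    have h2 : (0 : ℝ) < (2 * (1 - (4 : ℝ) ^ (γ - r)))⁻¹ := by rw [inv_pos]; linarith
    have h1 : (0 : ℝ) ≤ Fintype.card d := Nat.cast_nonneg _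
    have hK0 : 0 ≤ K := by rw [hK]; positivity
    positivity
  have hgle : ∑' k, g k ≤ M ^ 2 + K * L ^ 2 := by
    have heq : ∑' k : d → ℤ, ENNReal.ofReal (sobolevWeight γ k ^ 2) * ‖mFourierCoeff V k‖ₑ ^ 2 =
        ENNReal.ofReal (∑' k, g k) := by
      rw [ENNReal.ofReal_tsum_of_nonneg hg0 hgs]
      refine tsum_congr fun k => ?_
      rw [hg]
      simp only
      rw [ENNReal.ofReal_mul (sq_nonneg _), ← ofReal_norm, ← ENNReal.ofReal_pow (norm_nonneg _)]
    rw [hsq, heq] at hB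
    exact (ENNReal.ofReal_le_ofReal_iff hKL).1 hB
  -- conclude
  rw [integral_inner_fracLaplacian_self_eq_tsum hγ hv]
  calc ∑' k, f k ≤ ∑' k, (4 * Real.pi ^ 2) ^ γ * g k := by
        refine hfs.tsum_le_tsum (fun k => ?_) (hgs.mul_left _)
        calc f k ≤ (4 * Real.pi ^ 2) ^ γ * sobolevWeight γ k ^ 2 * ‖mFourierCoeff V k‖ ^ 2 :=
              mul_le_mul_of_nonneg_right (fracSymbol_le_mul_sobolevWeight_sq hγ k) (sq_nonneg _)
          _ = (4 * Real.pi ^ 2) ^ γ * g k := by rw [hg]; ring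
    _ = (4 * Real.pi ^ 2) ^ γ * ∑' k, g k := tsum_mul_left
    _ ≤ (4 * Real.pi ^ 2) ^ γ * (M ^ 2 + K * L ^ 2) :=
        mul_le_mul_of_nonneg_left hgle (Real.rpow_nonneg (by positivity) γ)

/-- The dissipation pairing is nonnegative: `∫⟪(-Δ)^γ v, v⟫ = ∑ₖ (4π²|k|²)^γ ‖v̂(k)‖² ≥ 0`. [folklore] -/
theorem integral_inner_fracLaplacian_self_nonneg {γ : ℝ} (hγ : 0 ≤ γ)
    {v : UnitAddTorus d → EuclideanSpace ℝ d} (hv : IsSmooth v) :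
    0 ≤ ∫ x, ⟪fracLaplacian γ v x, v x⟫_ℝ := by
  rw [integral_inner_fracLaplacian_self_eq_tsum hγ hv]
  exact tsum_nonneg fun k => mul_nonneg (fracSymbol_nonneg γ k) (sq_nonneg _)

/-- **Cor. 7.2, existential constant**: for `0 ≤ γ ≤ 1`, `γ < r` there is `C = C(d, γ, r) ≥ 0`
with `∫⟪(-Δ)^γ v, v⟫ ≤ C (M² + L²)` for every smooth `v` with `‖v‖ ≤ M`,
`‖v(x) - v(y)‖ ≤ L dist(x,y)^r`. [cite: Derosa2018, §7 Cor. 7.2] -/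
theorem exists_integral_inner_fracLaplacian_self_le (d : Type*) [Fintype d] [DecidableEq d]
    {γ r : ℝ} (hγ : 0 ≤ γ) (hγ1 : γ ≤ 1) (hγr : γ < r) :
    ∃ C : ℝ, 0 ≤ C ∧ ∀ (v : UnitAddTorus d → EuclideanSpace ℝ d), IsSmooth v → ∀ (M L : ℝ), 0 ≤ L →
      (∀ x, ‖v x‖ ≤ M) → (∀ x y, ‖v x - v y‖ ≤ L * dist x y ^ r) →
        ∫ x, ⟪fracLaplacian γ v x, v x⟫_ℝ ≤ C * (M ^ 2 + L ^ 2) := by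
  set K : ℝ := Fintype.card d * (1 + 4 * Fintype.card d) ^ γ * (4 : ℝ) ^ (-(2 * r)) *
    (2 * (1 - (4 : ℝ) ^ (γ - r)))⁻¹ with hK
  have hρ : (4 : ℝ) ^ (γ - r) < 1 := Real.rpow_lt_one_of_one_lt_of_neg (by norm_num) (by linarith)
  have hK0 : 0 ≤ K := by
    have h2 : (0 : ℝ) < (2 * (1 - (4 : ℝ) ^ (γ - r)))⁻¹ := by rw [inv_pos]; linarith
    have h1 : (0 : ℝ) ≤ Fintype.card d := Nat.cast_nonneg _
    rw [hK]; positivity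
  have h4 : 0 ≤ (4 * Real.pi ^ 2) ^ γ := Real.rpow_nonneg (by positivity) γ
  refine ⟨(4 * Real.pi ^ 2) ^ γ * max 1 K, mul_nonneg h4 (le_max_of_le_left zero_le_one), ?_⟩
  intro v hv M L hL hM hH
  have h := integral_inner_fracLaplacian_self_le_of_holder hγ hγ1 hγr hv hL hM hH
  have hK' : M ^ 2 + K * L ^ 2 ≤ max 1 K * (M ^ 2 + L ^ 2) :=
    calc M ^ 2 + K * L ^ 2 ≤ max 1 K * M ^ 2 + max 1 K * L ^ 2 :=
          add_le_add (le_mul_of_one_le_left (sq_nonneg _) (le_max_left _ _))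
            (mul_le_mul_of_nonneg_right (le_max_right _ _) (sq_nonneg _))
      _ = max 1 K * (M ^ 2 + L ^ 2) := by ring
  calc ∫ x, ⟪fracLaplacian γ v x, v x⟫_ℝ ≤ (4 * Real.pi ^ 2) ^ γ * (M ^ 2 + K * L ^ 2) := h
    _ ≤ (4 * Real.pi ^ 2) ^ γ * (max 1 K * (M ^ 2 + L ^ 2)) := mul_le_mul_of_nonneg_left hK' h4
    _ = (4 * Real.pi ^ 2) ^ γ * max 1 K * (M ^ 2 + L ^ 2) := by ring

end Torus

/-! ## The scale `X = δ_{q+1} ℓ^α δ_q^{1/2} λ_q` and its growth -/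

namespace BDSV

variable {β α a b : ℝ}

/-- `X⁻¹ = λ_q^{α(1-β+3α/2)+β-1} λ_{q+1}^{2β+βα}` for `X = δ_{q+1} ℓ^α δ_q^{1/2} λ_q` and `a ≥ 1`
(`δ_{q+1} = λ_{q+1}^{-2β}`, `δ_q^{1/2} = λ_q^{-β}`, `ℓ⁻¹ = λ_{q+1}^β λ_q^{1-β+3α/2}`). [folklore] -/
theorem energyScaleX_inv_eq (ha : 1 ≤ a) (q : ℕ) :
    (amp β a b (q + 1) * mollScale β α a b q ^ α * (Real.sqrt (amp β a b q) * freq a b q))⁻¹ =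
      freq a b q ^ (α * (1 - β + 3 * α / 2) + β - 1) * freq a b (q + 1) ^ (2 * β + β * α) := by
  have hf0 := freq_pos (b := b) ha q
  have hf1 := freq_pos (b := b) ha (q + 1)
  have hℓ := mollScale_pos (β := β) (α := α) (b := b) ha q
  -- `(ℓ^α)⁻¹ = (ℓ⁻¹)^α = λ_{q+1}^{βα} λ_q^{α(1-β+3α/2)}`
  have h1 : (mollScale β α a b q ^ α)⁻¹ =
      freq a b (q + 1) ^ (β * α) * freq a b q ^ (α * (1 - β + 3 * α / 2)) := by
    rw [← Real.inv_rpow hℓ.le, mollScale_inv_eq ha, Real.mul_rpow (Real.rpow_nonneg hf1.le _)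
      (Real.rpow_nonneg hf0.le _), ← Real.rpow_mul hf1.le, ← Real.rpow_mul hf0.le]
    congr 1
    rw [mul_comm (1 - β + 3 * α / 2) α]
  have hA : (amp β a b (q + 1))⁻¹ = freq a b (q + 1) ^ (2 * β) := by
    rw [amp, show (-2 : ℝ) * β = -(2 * β) by ring, Real.rpow_neg hf1.le, inv_inv]
  have hS : (Real.sqrt (amp β a b q))⁻¹ = freq a b q ^ β := by
    rw [sqrt_amp ha, Real.rpow_neg hf0.le, inv_inv]
  rw [mul_inv, mul_inv, mul_inv, h1, hA, hS, ← Real.rpow_neg_one (freq a b q)]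
  -- collect the powers of `λ_q` and of `λ_{q+1}`
  have e0 : freq a b q ^ (α * (1 - β + 3 * α / 2)) * (freq a b q ^ β * freq a b q ^ (-1 : ℝ)) =
      freq a b q ^ (α * (1 - β + 3 * α / 2) + β - 1) := by
    rw [← Real.rpow_add hf0, ← Real.rpow_add hf0]; ring_nf
  have e1 : freq a b (q + 1) ^ (2 * β) * freq a b (q + 1) ^ (β * α) =
      freq a b (q + 1) ^ (2 * β + β * α) := by rw [← Real.rpow_add hf1]
  calc freq a b (q + 1) ^ (2 * β) * (freq a b (q + 1) ^ (β * α) * freq a b q ^ (α * (1 - β + 3 * α / 2))) *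
        (freq a b q ^ β * freq a b q ^ (-1 : ℝ))
      = (freq a b q ^ (α * (1 - β + 3 * α / 2)) * (freq a b q ^ β * freq a b q ^ (-1 : ℝ))) *
          (freq a b (q + 1) ^ (2 * β) * freq a b (q + 1) ^ (β * α)) := by ring
    _ = _ := by rw [e0, e1]

/-- The scale `X = δ_{q+1} ℓ^α δ_q^{1/2} λ_q` is positive (`a ≥ 1`). [folklore] -/
theorem energyScaleX_pos (ha : 1 ≤ a) (q : ℕ) :
    0 < amp β a b (q + 1) * mollScale β α a b q ^ α * (Real.sqrt (amp β a b q) * freq a b q) :=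
  mul_pos (mul_pos (amp_pos ha _) (Real.rpow_pos_of_pos (mollScale_pos ha q) _))
    (mul_pos (Real.sqrt_pos.2 (amp_pos ha q)) (freq_pos ha q))

end BDSV

namespace DeRosa

open BDSV FunctionSpaces FunctionSpaces.Torus

/-- The flat three-torus `𝕋³ = (ℝ/ℤ)³`, local notation. -/
local notation "𝕋³" => UnitAddTorus (Fin 3)

/-- **`X = δ_{q+1} ℓ^α δ_q^{1/2} λ_q → ∞`** (footnote 5 of De Rosa §5.3: "`δ_{q+1}δ_q^{1/2}λ_q =
λ_{q+1}^{-2β}λ_q^{1-β} ≥ a^{b^q(1-β-2βb)} ≥ 1` (recall that `b < (1-β)/(2β)`)", here with the extra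
factor `ℓ^α`, harmless for `α` small): for `0 < β < 1`, `1 < b < (1-β)/(2β)` there is `α₀ > 0`
such that for `0 ≤ α < α₀` and every `K`, `K ≤ X` for all `q` once `a` is large — the
`a`-exponent of `X⁻¹`, `α(1-β+3α/2) + β - 1 + b(2β + βα)`, being negative.
[cite: Derosa2018, §5.3 Lemma 5.9 (proof, footnote 5)] -/
theorem exists_threshold_energyScaleX {β b : ℝ} (hβ : 0 < β) (hβ1 : β < 1) (hb : 1 < b)
    (hbβ : b < (1 - β) / (2 * β)) :
    ∃ α₀ : ℝ, 0 < α₀ ∧ ∀ α : ℝ, 0 ≤ α → α < α₀ → ∀ K : ℝ,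
      ∃ a₁ : ℝ, 1 < a₁ ∧ ∀ a : ℝ, a₁ ≤ a → ∀ q : ℕ,
        K ≤ amp β a b (q + 1) * mollScale β α a b q ^ α * (Real.sqrt (amp β a b q) * freq a b q) := by
  -- the margin `m = 1 - β - 2βb > 0`
  have hm : 0 < 1 - β - 2 * β * b := by
    have h2β : 0 < 2 * β := by linarith
    have := (lt_div_iff₀ h2β).1 hbβ
    linarith
  refine ⟨min 1 ((1 - β - 2 * β * b) / (3 + b)), lt_min one_pos (div_pos hm (by linarith)), ?_⟩
  intro α hα hαlt K
  have hα1 : α < 1 := lt_of_lt_of_le hαlt (min_le_left _ _)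
  have hαm : α * (3 + b) < 1 - β - 2 * β * b := by
    have h := lt_of_lt_of_le hαlt (min_le_right _ _)
    rwa [lt_div_iff₀ (by linarith : (0 : ℝ) < 3 + b)] at h
  -- the `a`-exponent of `X⁻¹` is negative
  have hE : (α * (1 - β + 3 * α / 2) + β - 1) + b * (2 * β + β * α) + b ^ 2 * 0 < 0 := by
    have h1 : α * (1 - β + 3 * α / 2) ≤ α * (5 / 2) := by
      refine mul_le_mul_of_nonneg_left ?_ hα
      nlinarith
    have h2 : b * (β * α) ≤ b * α := by
      have : β * α ≤ α := by nlinarith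
      exact mul_le_mul_of_nonneg_left this (by linarith)
    nlinarith
  obtain ⟨a₁, ha₁, h⟩ := exists_freq_triple_le hb.le hE K
  refine ⟨a₁, ha₁, fun a ha q => ?_⟩
  have ha1 : (1 : ℝ) ≤ a := ha₁.le.trans ha
  have hX := energyScaleX_pos (β := β) (α := α) (b := b) ha1 q
  have key := h a ha q
  rw [Real.rpow_zero, mul_one, ← energyScaleX_inv_eq ha1 q] at key
  -- `K X⁻¹ ≤ 1` and `X > 0` give `K ≤ X`
  by_cases hK : K ≤ 0
  · exact hK.trans hX.le
  · push Not at hK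
    rwa [← div_eq_mul_inv, div_le_one hX] at key

/-- **Part 0 of `DeRosa.perturbationStage_of_parts`: the NSR inputs satisfy the core hypotheses**
(De Rosa Lemma 5.9, proof on p. 15: "`|d/dt∫|v̄_q|²| ≤ 2|∫∇v̄_q·R̊̄_q| + 2ν∫|(-Δ)^{γ/2}v̄_q|² ≲
δ_{q+1}δ_q^{1/2}λ_qℓ^α`"): for `0 < γ < β < 1/3`, `1 < b < (1-β)/(2β)`, `θ > γ`, `α < α₀` and
`a ≥ a₀(β, b, α, γ, θ, C_in, C₀, C_H)`, every setting satisfying `DeRosa.NSRHypotheses` with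
constants `(C_in, C₀, C_H)` satisfies `DeRosa.CoreHypotheses` with constants
`(coreConst C_in, C₀)`, `coreConst C_in = 2(|C_in| + 1)`: the regularity package is that of the
trace-free NSR triple; the bounds (5.15)–(5.17) are weakened to the larger constant; and the energy
rate is `|-2∫∑ⱼ⟪R̊̄^{(j)},∂ⱼv̄⟫ - 2ν∫⟪(-Δ)^γv̄,v̄⟫| ≤ 6(|C_in|δ_{q+1}ℓ^α)(|C_in|δ_q^{1/2}λ_q) + 2C(C₀² + C_H²)`
(`Torus.abs_energyRate_le`, Cor. 7.2 with `[v̄_q(t)]_θ ≤ C_H`, `ν < 1`), which is at most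
`6(C_in'δ_{q+1}ℓ^α)(C_in'δ_q^{1/2}λ_q)` once `X = δ_{q+1}ℓ^αδ_q^{1/2}λ_q ≥ C(C₀² + C_H²)/9`
(`DeRosa.exists_threshold_energyScaleX`). [cite: Derosa2018, §5.3 Lemma 5.9 (proof, p. 15)] -/
theorem core_part :
    ∀ β : ℝ, 0 < β → β < 1 / 3 → ∀ γ : ℝ, 0 < γ → γ < β → ∀ b : ℝ, 1 < b → b < (1 - β) / (2 * β) →
      ∀ θ : ℝ≥0, γ < (θ : ℝ) →
        ∃ α₀ : ℝ, 0 < α₀ ∧ ∀ α : ℝ, 0 < α → α < α₀ → ∀ (Nbar : ℕ) (Cin C₀ : ℝ) (CH : ℝ≥0),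
          ∃ a₀ : ℝ, 1 < a₀ ∧ ∀ a : ℝ, a₀ ≤ a → ∀ ν : ℝ, 0 < ν → ν < 1 → ∀ S : Setting,
            NSRHypotheses ⟨β, α, a, b⟩ γ ν θ S Nbar Cin C₀ CH →
              CoreHypotheses ⟨β, α, a, b⟩ S Nbar (coreConst Cin) C₀ := by
  intro β hβ hβ3 γ hγ hγβ b hb hbβ θ hγθ
  obtain ⟨α₀, hα₀, hthr⟩ := exists_threshold_energyScaleX hβ (by linarith) hb hbβ
  refine ⟨α₀, hα₀, ?_⟩
  intro α hα hαlt Nbar Cin C₀ CH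
  -- the constant of Cor. 7.2 for `(γ, θ)` on `𝕋³`
  obtain ⟨Cd, hCd0, hCd⟩ := Torus.exists_integral_inner_fracLaplacian_self_le (Fin 3) hγ.le
    (by linarith) hγθ
  set K₀ : ℝ := Cd * (C₀ ^ 2 + (CH : ℝ) ^ 2) / 9 with hK₀
  obtain ⟨a₁, ha₁, hpar⟩ := hthr α hα.le hαlt K₀
  refine ⟨a₁, ha₁, ?_⟩
  intro a ha ν hν hν1 S H
  have ha1 : (1 : ℝ) ≤ a := ha₁.le.trans ha
  have hT := H.pos_T
  -- shorthand for the scales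
  have hδ1 := amp_pos (β := β) (b := b) ha1 (S.q + 1)
  have hℓ := mollScale_pos (β := β) (α := α) (b := b) ha1 S.q
  have hf := freq_pos (b := b) ha1 S.q
  have hXR : 0 ≤ amp β a b (S.q + 1) * mollScale β α a b S.q ^ α :=
    mul_nonneg hδ1.le (Real.rpow_nonneg hℓ.le _)
  have hXv : 0 ≤ Real.sqrt (amp β a b S.q) * freq a b S.q := mul_nonneg (Real.sqrt_nonneg _) hf.le
  -- `C_in ≤ |C_in| ≤ coreConst C_in`
  have hC1 : Cin ≤ coreConst Cin := by
    rw [coreConst]; linarith [le_abs_self Cin, abs_nonneg Cin]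
  have hmonoR : ∀ N : ℕ, Cin * (amp β a b (S.q + 1) * mollScale β α a b S.q ^ (-(N : ℝ) + α)) ≤
      coreConst Cin * (amp β a b (S.q + 1) * mollScale β α a b S.q ^ (-(N : ℝ) + α)) := fun N =>
    mul_le_mul_of_nonneg_right hC1 (mul_nonneg hδ1.le (Real.rpow_nonneg hℓ.le _))
  refine
    { pos_T := H.pos_T
      profile := H.profile
      eulerReynolds := TripleRegularity.ofFracNSReynolds H.fracNSR H.traceFree
      stress_support := H.stress_support
      velocity_sup := H.velocity_sup
      velocity := fun N hN => (H.velocity N hN).mono (mul_le_mul_of_nonneg_right hC1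
        (mul_nonneg hXv (Real.rpow_nonneg hℓ.le _)))
      stress := fun N hN => (H.stress N hN).mono (hmonoR N)
      transport := fun N hN => (H.transport N hN).mono (mul_le_mul_of_nonneg_right hC1
        (mul_nonneg (mul_nonneg (mul_nonneg hδ1.le (Real.sqrt_nonneg _)) hf.le)
          (Real.rpow_nonneg hℓ.le _)))
      energy_gap := H.energy_gap
      energy_rate := fun t ht => ?_ }
  -- ### the energy rate at time `t`
  have hD := H.fracNSR.hasDerivWithinAt_energy hT hγ.le ht
  rw [hD.derivWithin (uniqueDiffOn_Icc hT t ht)]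
  -- pointwise inputs, with the constant `|C_in|`
  set BR : ℝ := |Cin| * (amp β a b (S.q + 1) * mollScale β α a b S.q ^ α) with hBR
  set Bv : ℝ := |Cin| * (Real.sqrt (amp β a b S.q) * freq a b S.q) with hBv
  have hBR0 : 0 ≤ BR := mul_nonneg (abs_nonneg _) hXR
  have hBv0 : 0 ≤ Bv := mul_nonneg (abs_nonneg _) hXv
  have hvt : IsSmooth (S.vbar t) := H.fracNSR.smooth_velocity.isSmooth_slice ht
  have hR : ∀ x (j : Fin 3), ‖S.Rbar t x j‖ ≤ BR := by
    intro x j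
    have hRt := (H.stress 0 (Nat.zero_le _)).mono (mul_le_mul_of_nonneg_right (le_abs_self Cin)
      (mul_nonneg hδ1.le (Real.rpow_nonneg hℓ.le _))) t ht
    simp only [Nat.cast_zero, neg_zero, zero_add] at hRt
    exact (norm_le_pi_norm _ j).trans (norm_le_of_eContDiffHolderNorm_zero_le hBR0 hRt x)
  have hDv : ∀ x (j : Fin 3), ‖Torus.partialDeriv j (S.vbar t) x‖ ≤ Bv := by
    intro x j
    have hv := (H.velocity 0 (Nat.zero_le _)).mono (mul_le_mul_of_nonneg_right (le_abs_self Cin)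
      (mul_nonneg hXv (Real.rpow_nonneg hℓ.le _))) t ht
    simp only [Nat.cast_zero, neg_zero, Real.rpow_zero, mul_one] at hv
    exact norm_partialDeriv_le_of_eContDiffHolderNorm_le (hvt.isContDiff (by simp)) hBv0 hv j x
  have hrate := Torus.abs_energyRate_le (v := S.vbar) (R := S.Rbar) (t := t) hBR0 hR hDv
  rw [Fintype.card_fin] at hrate
  -- the dissipation: `0 ≤ ∫⟪(-Δ)^γv̄, v̄⟫ ≤ Cd (C₀² + C_H²)`
  set Q : ℝ := ∫ x, ⟪Torus.fracLaplacian γ (S.vbar t) x, S.vbar t x⟫_ℝ with hQ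
  have hQ0 : 0 ≤ Q := Torus.integral_inner_fracLaplacian_self_nonneg hγ.le hvt
  have hQle : Q ≤ Cd * (C₀ ^ 2 + (CH : ℝ) ^ 2) := by
    refine hCd (S.vbar t) hvt C₀ CH CH.coe_nonneg (fun x => H.velocity_sup t ht x) fun x y => ?_
    rw [← dist_eq_norm]
    exact (H.holder t ht).dist_le x y
  -- the threshold: `X ≥ K₀`
  have hX := hpar a ha S.q
  -- assemble: `|-2∫… - 2νQ| ≤ 6 BR Bv + 2 Q ≤ 6 |C_in|² X + 18 X ≤ 24 (|C_in|+1)² X`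
  have habs : |-2 * (∫ x, ∑ j, ⟪S.Rbar t x j, Torus.partialDeriv j (S.vbar t) x⟫_ℝ) - 2 * ν * Q| ≤
      6 * BR * Bv + 2 * Q := by
    refine (abs_sub _ _).trans (add_le_add ?_ ?_)
    · calc |-2 * ∫ x, ∑ j, ⟪S.Rbar t x j, Torus.partialDeriv j (S.vbar t) x⟫_ℝ|
          ≤ 2 * (3 : ℕ) * BR * Bv := hrate
        _ = 6 * BR * Bv := by push_cast; ring
    · rw [abs_of_nonneg (by positivity)]
      nlinarith
  refine habs.trans ?_
  set X : ℝ := amp β a b (S.q + 1) * mollScale β α a b S.q ^ α *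
    (Real.sqrt (amp β a b S.q) * freq a b S.q) with hXdef
  have hX0 : 0 ≤ X := mul_nonneg hXR hXv
  have e1 : 6 * BR * Bv = 6 * |Cin| ^ 2 * X := by rw [hBR, hBv, hXdef]; ring
  have e2 : 6 * (coreConst Cin * (amp β a b (S.q + 1) * mollScale β α a b S.q ^ α)) *
      (coreConst Cin * (Real.sqrt (amp β a b S.q) * freq a b S.q)) =
        24 * (|Cin| + 1) ^ 2 * X := by rw [coreConst, hXdef]; ring
  rw [e1, e2]
  have h18 : 2 * Q ≤ 18 * X := by
    have : Cd * (C₀ ^ 2 + (CH : ℝ) ^ 2) ≤ 9 * X := by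
      have := hX
      rw [hK₀] at this
      linarith
    linarith
  nlinarith [abs_nonneg Cin, mul_nonneg (abs_nonneg Cin) hX0]

end DeRosa

end Literature.Analysis.FluidPDE
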